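/-
Copyright (c) 2026 the M5 tree authors. Released under Apache 2.0 license.
This file is NOT FLT material: it relates the vendored FLT packet (files 1–15 of this directory,
[FLTProject2025]) to the tree's own `Literature/NumberTheory/Automorphic/AdeleBaseChange.lean`.
-/
import Literature.NumberTheory.AdelicBaseChange.NumberFieldAdeleBaseChange
import Literature.NumberTheory.Automorphic.AdeleBaseChange
import HarnessLib

/-!
# The packet's base-change MAPS are the tree's base-change maps

Topic `NumberTheory/AdelicBaseChange` — file 16 (bridge) of the ADELIC BASE-CHANGE PACKET.

The tree has had, since `Literature/NumberTheory/Automorphic/AdeleBaseChange.lean`, the base-change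
MAPS along an extension (`Literature.NumberTheory.Automorphic.adicCompletionOfLiesOver K L v w :
K_v →+* L_w`, `….adicCompletionOfUnder`, `….FiniteAdeleRing.baseChange A K L B : 𝔸_K^∞ →+* 𝔸_L^∞`,
`….infiniteCompletionOfComap`, `….InfiniteAdeleRing.baseChange F E`, `….AdeleRing.baseChange F E :
𝔸_F →+* 𝔸_E`, `….AdeleRing.ideleBaseChange`), with dozens of consumer files, but not the tensor-product
ISOMORPHISMS; the packet (files 6, 12, 13, 14, 15) supplies the isomorphisms, phrased through FLT's
own copies of the maps (`IsDedekindDomain.HeightOneSpectrum.Extension.adicCompletionSemialgHom`,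
`IsDedekindDomain.FiniteAdeleRing.mapRingHom`/`mapSemialgHom`,
`NumberField.InfinitePlace.Completion.comapHom`, `NumberField.InfiniteAdeleRing.baseChange`,
`NumberField.AdeleRing.baseChange`). This file records that the two families of maps COINCIDE —
definitionally: both are Mathlib's `UniformSpace.Completion.map` of `K → L` between the `WithVal`
synonyms at finite places, Mathlib's `NumberField.LiesOver.completionMap` at infinite places, and
`RestrictedProduct.mapAlong…` / componentwise maps globally (every such identification below is `rfl`
or an `ext` of `rfl`s) — and restates the packet's isomorphisms `L ⊗[K] K_v ≃ₐ[L] ∏_{w∣v} L_w` (T1),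
`L ⊗[K] 𝔸_K^∞ ≃ₐ[L] 𝔸_L^∞` (T4), `L ⊗[K] K_∞ ≃ₐ[L] L_∞` (T6) and `L ⊗[K] 𝔸_K ≃ₐ[L] 𝔸_L` (T7) on
elementary tensors in terms of the TREE's maps: `l ⊗ a ↦ (l)_{𝔸_L} · baseChange a`. Consequently the
tree's `AdeleRing.baseChange F E` is the map `x ↦ 1 ⊗ x` of Cassels–Fröhlich, Ch. II §14, (14.2)
`V_K = K ⊗_k V_k` — the sentence the tree file's docstring left unproved ("the tensor description
itself is not needed and not proved here") — and likewise for its local and archimedean maps.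

Also: the `Prop` instance `extensionLiesOver` turning FLT's `w : v.Extension B` (file 2: `w ∩ A = v`)
into Mathlib's `w.1.asIdeal.LiesOver v.asIdeal`, the form the tree's local maps are indexed by.

Everything is PROVED; no named facts; nothing of FLT or of the tree is re-declared (the statements only
mention existing declarations of the two files).

## References
* J. W. S. Cassels, A. Fröhlich (eds.), *Algebraic Number Theory* (1967), Ch. II (Cassels, *Global
  fields*), §10 (`K ⊗_k k_v = ⊕ K_w`, (10.2)), §14 (`V_k ⊗_k K = V_K`, (14.2)). [CasselsFrohlichANT1967]
* K. Buzzard, R. Taylor et al., *FLT* (Lean 4 project), Imperial College London, 2025–: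
  `FLT/DedekindDomain/Completion/BaseChange.lean`, `FLT/DedekindDomain/FiniteAdeleRing/BaseChange.lean`,
  `FLT/NumberField/Completion/Infinite.lean`, `FLT/NumberField/InfiniteAdeleRing.lean`,
  `FLT/NumberField/AdeleRing.lean`. [FLTProject2025]
-/

noncomputable section

open scoped TensorProduct

namespace Literature.NumberTheory.AdelicBaseChange

/-! ### FLT's `v.Extension B` and Mathlib's `LiesOver` -/

section ExtensionLiesOver

open IsDedekindDomain IsDedekindDomain.HeightOneSpectrum

variable {A B : Type*} [CommRing A] [IsDedekindDomain A] [CommRing B] [IsDedekindDomain B]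
  [Algebra A B] [Algebra.IsIntegral A B]

/-- For a place `w` of `L` above `v` in FLT's sense (`w : v.Extension B`, packet file 2, i.e.
`w ∩ A = v`), Mathlib's `LiesOver` witness `w.1.asIdeal.LiesOver v.asIdeal` — the glue between FLT's
`Extension` and the `LiesOver` language of Mathlib and of the tree's `adicCompletionOfLiesOver`.
A `Prop` instance. [folklore] -/
instance extensionLiesOver (v : HeightOneSpectrum A) (w : v.Extension B) :
    w.1.asIdeal.LiesOver v.asIdeal :=
  ⟨by obtain ⟨w, rfl⟩ := w; rfl⟩

end ExtensionLiesOver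

/-! ### Finite places: `K_v → L_w` -/

section Local

open IsDedekindDomain IsDedekindDomain.HeightOneSpectrum

variable {A : Type*} (K L : Type*) {B : Type*} [CommRing A] [IsDedekindDomain A] [CommRing B]
  [IsDedekindDomain B] [Algebra A B] [Module.IsTorsionFree A B] [Module.Finite A B]
  [Field K] [Field L] [Algebra K L] [Algebra A K] [IsFractionRing A K] [Algebra A L]
  [IsScalarTower A K L] [Algebra B L] [IsFractionRing B L] [IsScalarTower A B L]

/-- **FLT's local map is the tree's local map.** For a place `w` of `L` above the place `v` of `K`
(`w : v.Extension B`, i.e. `w ∩ A = v`), FLT's `K_v →ₛₐ[K → L] L_w`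
(`Extension.adicCompletionSemialgHom`, packet file 6) and the tree's
`Literature.NumberTheory.Automorphic.adicCompletionOfLiesOver K L v w : K_v →+* L_w` (for any
`LiesOver` witness) are the same function — both are the completion of `K → L` between the
`v`-adic and `w`-adic uniformities (Cassels–Fröhlich, Ch. II §10: the canonical embedding
`k_v → K_w`). Definitional (`rfl`).
[cite: CasselsFrohlichANT1967, Ch. II §10 (canonical map k_v → K_w); FLTProject2025, FLT/DedekindDomain/Completion/BaseChange.lean · IsDedekindDomain.HeightOneSpectrum.Extension.adicCompletionSemialgHom] -/
theorem adicCompletionSemialgHom_apply_eq_adicCompletionOfLiesOver (v : HeightOneSpectrum A)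
    (w : v.Extension B) [w.1.asIdeal.LiesOver v.asIdeal] (x : v.adicCompletion K) :
    w.adicCompletionSemialgHom K L x =
      Literature.NumberTheory.Automorphic.adicCompletionOfLiesOver K L v w.1 x := rfl

/-- The same identification in the "place below" form used by the finite-adele maps: for any place
`w` of `L`, FLT's `K_{w ∩ A} → L_w` (`adicCompletionSemialgHom K L ⟨w, rfl⟩`) is the tree's
`Literature.NumberTheory.Automorphic.adicCompletionOfUnder A K L w`. Definitional (`rfl`).
[cite: CasselsFrohlichANT1967, Ch. II §10 (canonical map k_v → K_w); FLTProject2025, FLT/DedekindDomain/Completion/BaseChange.lean · IsDedekindDomain.HeightOneSpectrum.Extension.adicCompletionSemialgHom] -/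
theorem adicCompletionSemialgHom_apply_eq_adicCompletionOfUnder (w : HeightOneSpectrum B)
    (x : (w.under A).adicCompletion K) :
    Extension.adicCompletionSemialgHom K L (v := w.under A) ⟨w, rfl⟩ x =
      Literature.NumberTheory.Automorphic.adicCompletionOfUnder A K L w x := rfl

/-- Ring-hom form: FLT's local map, as a ring homomorphism `K_{w ∩ A} →+* L_w`, equals the tree's
`adicCompletionOfUnder A K L w`.
[cite: CasselsFrohlichANT1967, Ch. II §10 (canonical map k_v → K_w); FLTProject2025, FLT/DedekindDomain/Completion/BaseChange.lean · IsDedekindDomain.HeightOneSpectrum.Extension.adicCompletionSemialgHom] -/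
theorem adicCompletionSemialgHom_toRingHom_eq_adicCompletionOfUnder (w : HeightOneSpectrum B) :
    (Extension.adicCompletionSemialgHom K L (v := w.under A) ⟨w, rfl⟩ :
        (w.under A).adicCompletion K →+* w.adicCompletion L) =
      Literature.NumberTheory.Automorphic.adicCompletionOfUnder A K L w :=
  RingHom.ext fun x => adicCompletionSemialgHom_apply_eq_adicCompletionOfUnder K L w x

/-- **T1 through the tree's map (Cassels–Fröhlich II (10.2) for `adicCompletionOfLiesOver`).** The
packet's `L`-algebra isomorphism `IsDedekindDomain.HeightOneSpectrum.adicCompletion.baseChangeAlgEquiv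
K L B v : L ⊗[K] K_v ≃ₐ[L] ∏_{w ∣ v} L_w` (file 6) has `w`-component `l ⊗ x ↦ l · ι_w(x)` where
`ι_w = Literature.NumberTheory.Automorphic.adicCompletionOfLiesOver K L v w : K_v →+* L_w` is the TREE's
local map: so `K_v ⊗_K L ≅ ∏_{w∣v} L_w` holds for the maps the tree's consumers use.
[cite: CasselsFrohlichANT1967, Ch. II §10 Theorem (10.2)] -/
theorem adicCompletion_baseChangeAlgEquiv_tmul_apply [FiniteDimensional K L] (v : HeightOneSpectrum A)
    (l : L) (x : v.adicCompletion K) (w : v.Extension B) :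
    adicCompletion.baseChangeAlgEquiv K L B v (l ⊗ₜ[K] x) w =
      algebraMap L (w.1.adicCompletion L) l *
        Literature.NumberTheory.Automorphic.adicCompletionOfLiesOver K L v w.1 x :=
  rfl

end Local

/-! ### Finite adeles: `𝔸_K^∞ → 𝔸_L^∞` and the isomorphism `L ⊗[K] 𝔸_K^∞ ≅ 𝔸_L^∞` (T4) -/

section FiniteAdele

open IsDedekindDomain IsDedekindDomain.HeightOneSpectrum
open scoped IsDedekindDomain

variable (A K L B : Type*) [CommRing A] [CommRing B] [Algebra A B] [Field K] [Field L]
    [Algebra A K] [IsFractionRing A K] [Algebra B L] [IsDedekindDomain A]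
    [Algebra K L] [Algebra A L] [IsScalarTower A B L] [IsScalarTower A K L] [Module.Finite A B]
    [IsDedekindDomain B] [IsFractionRing B L] [Module.IsTorsionFree A B]

/-- **FLT's finite-adele base change is the tree's.** `IsDedekindDomain.FiniteAdeleRing.mapRingHom
A K L B` (packet file 12: `RestrictedProduct.mapAlongRingHom` along `w ↦ w ∩ A` with FLT's local maps)
equals `Literature.NumberTheory.Automorphic.FiniteAdeleRing.baseChange A K L B` (the same
`mapAlongRingHom` with the tree's local maps): componentwise both send `(x_v)_v` to
`(x_{w ∩ A})_w ∈ ∏'_w L_w` — Cassels–Fröhlich, Ch. II §14, the canonical map `V_k → V_K`.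
[cite: CasselsFrohlichANT1967, Ch. II §14 (canonical map V_k → V_K); FLTProject2025, FLT/DedekindDomain/FiniteAdeleRing/BaseChange.lean · IsDedekindDomain.FiniteAdeleRing.mapRingHom] -/
theorem finiteAdeleRing_mapRingHom_eq_baseChange :
    FiniteAdeleRing.mapRingHom A K L B =
      Literature.NumberTheory.Automorphic.FiniteAdeleRing.baseChange A K L B :=
  RingHom.ext fun _ => FiniteAdeleRing.ext L fun _ => rfl

/-- Pointwise form for the continuous semialgebra-hom packaging `mapSemialgHom` (packet file 12):
`mapSemialgHom A K L B x = Literature.NumberTheory.Automorphic.FiniteAdeleRing.baseChange A K L B x`.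
Definitional up to `FiniteAdeleRing.ext`.
[cite: CasselsFrohlichANT1967, Ch. II §14 (canonical map V_k → V_K); FLTProject2025, FLT/DedekindDomain/FiniteAdeleRing/BaseChange.lean · IsDedekindDomain.FiniteAdeleRing.mapSemialgHom] -/
theorem finiteAdeleRing_mapSemialgHom_apply_eq_baseChange (x : 𝔸ᶠ[A, K]) :
    FiniteAdeleRing.mapSemialgHom A K L B x =
      Literature.NumberTheory.Automorphic.FiniteAdeleRing.baseChange A K L B x :=
  FiniteAdeleRing.ext L fun _ => rfl

variable [Algebra 𝔸ᶠ[A, K] 𝔸ᶠ[B, L]] [FiniteAdeleRing.ComapFiberwiseSMul A K L B]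
  [FiniteDimensional K L]

/-- **T4 through the tree's map.** The packet's `L`-algebra isomorphism
`IsDedekindDomain.FiniteAdeleRing.baseChangeAlgEquiv A K L B : L ⊗[K] 𝔸_K^∞ ≃ₐ[L] 𝔸_L^∞`
(file 12; Cassels–Fröhlich, Ch. II §14 (14.2), finite part) sends an elementary tensor `l ⊗ x` to
`(l)_{𝔸_L^∞} · baseChange x`, where `baseChange` is the TREE's
`Literature.NumberTheory.Automorphic.FiniteAdeleRing.baseChange A K L B`. (The `Algebra 𝔸ᶠ[A, K] 𝔸ᶠ[B, L]`
/ `ComapFiberwiseSMul` hypotheses are file 12's section context; number fields get them from the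
scoped instances of file 15, `open scoped NumberField.AdeleRing`.)
[cite: CasselsFrohlichANT1967, Ch. II §14 Lemma (14.2), finite places] -/
theorem finiteAdeleRing_baseChangeAlgEquiv_tmul (l : L) (x : 𝔸ᶠ[A, K]) :
    FiniteAdeleRing.baseChangeAlgEquiv A K L B (l ⊗ₜ[K] x) =
      algebraMap L 𝔸ᶠ[B, L] l *
        Literature.NumberTheory.Automorphic.FiniteAdeleRing.baseChange A K L B x := by
  rw [← finiteAdeleRing_mapSemialgHom_apply_eq_baseChange]
  exact SemialgHom.baseChange_of_algebraMap_tmul _ l x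

end FiniteAdele

/-! ### Number fields: infinite places, infinite adeles, adeles (T6, T7) -/

section NumberField

open NumberField NumberField.InfinitePlace
open scoped NumberField.InfiniteAdeleRing NumberField.AdeleRing IsDedekindDomain

variable (K L : Type*) [Field K] [Field L] [Algebra K L]

/-- **FLT's local map at an infinite place is the tree's.** For an infinite place `w` of `L`,
FLT's `comapHom rfl : K_{w|K} →ₛₐ[K → L] L_w` (packet file 13) and the tree's
`Literature.NumberTheory.Automorphic.infiniteCompletionOfComap K L w` are the same function: both are
Mathlib's `NumberField.LiesOver.completionMap` (the two `LiesOver` witnesses are proofs of one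
proposition). Definitional (`rfl`).
[cite: CasselsFrohlichANT1967, Ch. II §10 (canonical map k_v → K_w, archimedean v); FLTProject2025, FLT/NumberField/Completion/Infinite.lean · NumberField.InfinitePlace.Completion.comapHom] -/
theorem infinitePlace_comapHom_apply_eq_infiniteCompletionOfComap (w : InfinitePlace L)
    (x : (w.comap (algebraMap K L)).Completion) :
    Completion.comapHom (w := w) rfl x =
      Literature.NumberTheory.Automorphic.infiniteCompletionOfComap K L w x := rfl

/-- **FLT's infinite-adele base change is the tree's**: `NumberField.InfiniteAdeleRing.baseChange K L`
(packet file 14) and `Literature.NumberTheory.Automorphic.InfiniteAdeleRing.baseChange K L` agree on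
every `x ∈ K_∞` (componentwise the local maps above). Definitional (`rfl`).
[cite: CasselsFrohlichANT1967, Ch. II §14 (canonical map V_k → V_K, archimedean part); FLTProject2025, FLT/NumberField/InfiniteAdeleRing.lean · NumberField.InfiniteAdeleRing.baseChange] -/
theorem infiniteAdeleRing_baseChange_apply_eq (x : K∞) :
    NumberField.InfiniteAdeleRing.baseChange K L x =
      Literature.NumberTheory.Automorphic.InfiniteAdeleRing.baseChange K L x := rfl

/-- **T6 through the tree's map.** The packet's `L ⊗[K] K_∞ ≃ₐ[L] L_∞`
(`NumberField.InfiniteAdeleRing.baseChangeAlgEquiv`, file 14) sends `l ⊗ x` to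
`(l)_{L_∞} · baseChange x` with the TREE's `InfiniteAdeleRing.baseChange K L`.
[cite: CasselsFrohlichANT1967, Ch. II §14 Lemma (14.2), archimedean places] -/
theorem infiniteAdeleRing_baseChangeAlgEquiv_tmul [NumberField K] [NumberField L] (l : L) (x : K∞) :
    NumberField.InfiniteAdeleRing.baseChangeAlgEquiv K L (l ⊗ₜ[K] x) =
      algebraMap L L∞ l * Literature.NumberTheory.Automorphic.InfiniteAdeleRing.baseChange K L x :=
  rfl

variable [NumberField K] [NumberField L]

/-- **FLT's adelic base change is the tree's**: `NumberField.AdeleRing.baseChange K L : 𝔸_K →SA 𝔸_L`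
(packet file 15, infinite part × finite part) and the tree's
`Literature.NumberTheory.Automorphic.AdeleRing.baseChange K L : 𝔸_K →+* 𝔸_L` agree on every adele —
Cassels–Fröhlich, Ch. II §14: the canonical map `V_k → V_K`.
[cite: CasselsFrohlichANT1967, Ch. II §14 (canonical map V_k → V_K); FLTProject2025, FLT/NumberField/AdeleRing.lean · NumberField.AdeleRing.baseChange] -/
theorem adeleRing_baseChange_apply_eq (x : 𝔸 K) :
    NumberField.AdeleRing.baseChange K L x =
      Literature.NumberTheory.Automorphic.AdeleRing.baseChange K L x :=
  Prod.ext rfl (finiteAdeleRing_mapSemialgHom_apply_eq_baseChange (𝓞 K) K L (𝓞 L) x.2)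

/-- Ring-hom form of the previous statement.
[cite: CasselsFrohlichANT1967, Ch. II §14 (canonical map V_k → V_K); FLTProject2025, FLT/NumberField/AdeleRing.lean · NumberField.AdeleRing.baseChange] -/
theorem adeleRing_baseChange_toRingHom_eq :
    (NumberField.AdeleRing.baseChange K L : (𝔸 K) →+* 𝔸 L) =
      Literature.NumberTheory.Automorphic.AdeleRing.baseChange K L :=
  RingHom.ext fun x => adeleRing_baseChange_apply_eq K L x

/-- **T7 through the tree's map (Cassels–Fröhlich II (14.2) for the tree's `𝔸_F → 𝔸_E`).** The
packet's `L`-algebra isomorphism `NumberField.AdeleRing.baseChangeAlgEquiv K L : L ⊗[K] 𝔸_K ≃ₐ[L] 𝔸_L`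
(file 15, under its scoped `Algebra 𝔸ᶠ[K] 𝔸ᶠ[L]` instances) sends `l ⊗ a` to
`(l)_{𝔸_L} · baseChange a`, where `baseChange` is the TREE's
`Literature.NumberTheory.Automorphic.AdeleRing.baseChange K L`. So the tree's base change is the map
`a ↦ 1 ⊗ a` of `𝔸_L = L ⊗_K 𝔸_K` — the tensor-product description its own docstring deferred.
[cite: CasselsFrohlichANT1967, Ch. II §14 Lemma (14.2)] -/
theorem adeleRing_baseChangeAlgEquiv_tmul (l : L) (a : 𝔸 K) :
    NumberField.AdeleRing.baseChangeAlgEquiv K L (l ⊗ₜ[K] a) =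
      algebraMap L (𝔸 L) l * Literature.NumberTheory.Automorphic.AdeleRing.baseChange K L a := by
  rw [NumberField.AdeleRing.baseChangeAlgEquiv_apply, adeleRing_baseChange_apply_eq]

/-- `baseChangeAlgEquiv (1 ⊗ a) = baseChange a`: the tree's `AdeleRing.baseChange K L` IS
`a ↦ 1 ⊗ a` read through the isomorphism `L ⊗[K] 𝔸_K ≅ 𝔸_L`.
[cite: CasselsFrohlichANT1967, Ch. II §14 Lemma (14.2)] -/
theorem adeleRing_baseChangeAlgEquiv_one_tmul (a : 𝔸 K) :
    NumberField.AdeleRing.baseChangeAlgEquiv K L (1 ⊗ₜ[K] a) =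
      Literature.NumberTheory.Automorphic.AdeleRing.baseChange K L a := by
  rw [adeleRing_baseChangeAlgEquiv_tmul, map_one, one_mul]

/-- The tree's idele base change `𝔸_Kˣ → 𝔸_Lˣ` (`AdeleRing.ideleBaseChange`) is, on underlying
adeles, FLT's `NumberField.AdeleRing.baseChange` (hence `a ↦ 1 ⊗ a`).
[cite: CasselsFrohlichANT1967, Ch. II §14 (canonical map V_k → V_K) and §16 (ideles); FLTProject2025, FLT/NumberField/AdeleRing.lean · NumberField.AdeleRing.baseChange] -/
theorem coe_ideleBaseChange_eq_baseChange (x : (𝔸 K)ˣ) :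
    ((Literature.NumberTheory.Automorphic.AdeleRing.ideleBaseChange K L x : (𝔸 L)ˣ) : 𝔸 L) =
      NumberField.AdeleRing.baseChange K L (x : 𝔸 K) :=
  (adeleRing_baseChange_apply_eq K L (x : 𝔸 K)).symm

end NumberField

end Literature.NumberTheory.AdelicBaseChange

end
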